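import Summits.BirchSwinnertonDyer.Uniform.U2.TransportA
import Literature.NumberTheory.QuadraticFields.KroneckerSplitting
import Literature.NumberTheory.QuadraticFields.FundamentalDiscriminant
import Literature.NumberTheory.QuadraticFields.QuadraticDedekindZeta
import HarnessLib

/-!
# Track U2, route A (cell `bsd-uniform`, seat u2-p1): the control binders in ARITHMETIC form —
# Jacobi symbols and congruences instead of «`p` splits in `ℚ(√d)`»

HONEST FRAMING (cell `bsd-uniform`, HOME run/shared/lean/pub/bsd-uniform/, verbatim in every file of
the seat): this file adds NO arithmetic input. It re-expresses the hypotheses of Mazur–Rubin 2010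
Prop. 3.3 / Cor. 3.4 (ii) (as consumed by `TransportA.routeA_rank_eq_and_sha_two_eq_bot`) through the
decomposition law in quadratic fields, which the tree PROVES
(`Literature/NumberTheory/QuadraticFields/KroneckerSplitting.lean`: an odd prime `p` splits in a
quadratic field `F` iff `jacobiSym d_F p = 1`; `2` splits iff `d_F ≡ 1 (mod 8)`;
`FundamentalDiscriminant.lean` + `SquareRootGenerator.lean`: `d_F = d` for `F = ℚ(√d)`, `d ≡ 1 (4)`
square-free; `QuadraticDedekindZeta.lean`: `d_F > 0 ⇒ F` totally real), and it CONSTRUCTS the field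
`ℚ(√d)` (Mathlib's `QuadraticAlgebra ℚ d 0`) so that the transport theorem quantifies over `(E, d)`
alone, with DECIDABLE class-level binders: `d ≡ 1 (mod 8)` square-free; `jacobiSym d ℓ = 1` at every
odd additive prime and every odd multiplicative prime with `ord_ℓ(Δ)` even; `ℓ ∤ d` at multiplicative
primes with `ord_ℓ(Δ)` odd; `d > 0` if `Δ_E > 0`; `E(ℚ_q)[2] = 0` at the primes `q ∣ d` (`a_q` odd,
INGREDIENTS F9). Relative theorem; converts PAIRS, never the class X5; books nothing; no per-curve
certificate counted as uniform. Residue unchanged (R-A1…R-A7, HOME/RESIDUE.md).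

## Contents
* `not_isSquare_rat_of_squarefree` — a square-free integer `d ≠ 1` is not a rational square.
* `exists_quadraticField_of_squarefree` — the field `ℚ(√d)`: `[F : ℚ] = 2`, `∃ x, x² = d`, and
  `d_F = d` when `d ≡ 1 (mod 4)`.
* `discr_eq_of_sq_eq` — any quadratic `F ∋ √d` (`d ≡ 1 (4)` square-free, `≠ 1`) has `d_F = d`.
* `routeA_explicit` — `routeA_rank_eq_and_sha_two_eq_bot` with arithmetic binders.
* `routeA_explicit_bsdp_iff` — the same hand-over to the analytic side
  (`BSD(E^{(d)},2) ⟺ ord₂ #Ш_an(E^{(d)}) = 0`) with arithmetic binders.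

References: Mazur–Rubin 2010 Cor. 3.4 (ii) / Prop. 4.2 (the `d ≡ 1 (mod 8Δ)` packaging)
[MazurRubin2010]; Marcus, *Number Fields*, Ch. 3 Thm. 25 (decomposition law) [Marcus2018].
-/

noncomputable section

open scoped Classical AddSubgroup

open NumberField WeierstrassCurve Literature.NumberTheory.EllipticCurves
  Literature.NumberTheory.EllipticCurves.Rank1Residual
  Literature.NumberTheory.QuadraticFields
  Summit.BirchSwinnertonDyer.Rank1Residual

namespace Summit.BirchSwinnertonDyer.Uniform.U2

/-! ## §1 The quadratic field `ℚ(√d)` and its discriminant -/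

section QuadraticField

/-- A square-free integer `d ≠ 1` is not the square of a rational number (a rational square root is
an integer `n` by integral closedness, and `n² = d` square-free forces `n = ±1`). [folklore] -/
theorem not_sq_eq_of_squarefree {d : ℤ} (hd : Squarefree d) (hd1 : d ≠ 1) (r : ℚ) :
    r ^ 2 ≠ (d : ℚ) := by
  intro hr
  have hint : IsIntegral ℤ r := by
    refine ⟨Polynomial.X ^ 2 - Polynomial.C d, by monicity!, ?_⟩
    simp only [Polynomial.eval₂_sub, Polynomial.eval₂_X_pow, Polynomial.eval₂_C]
    rw [hr]
    simp
  obtain ⟨n, hn⟩ := IsIntegrallyClosed.isIntegral_iff.mp hint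
  rw [← hn, eq_intCast] at hr
  have hn2 : n ^ 2 = d := by exact_mod_cast hr
  have hnd : n * n = d := by rw [← sq]; exact hn2
  have hu : IsUnit n := hd n ⟨1, by rw [mul_one, hnd]⟩
  rcases Int.isUnit_iff.mp hu with rfl | rfl <;> simp at hnd <;> exact hd1 hnd.symm

variable {F : Type} [Field F] [NumberField F]

/-- **`d_F = d`** for a quadratic field `F` containing a square root of a square-free `d ≡ 1 (mod 4)`,
`d ≠ 1`: `d_F = d·q²` (tree `NumberField.exists_discr_eq_mul_sq`) and both are fundamental
discriminants (`isFundamentalDiscriminant_discr`), hence equal (`eq_of_isFundamental_of_eq_mul_sq`).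
[folklore] -/
theorem discr_eq_of_sq_eq (hF : Module.finrank ℚ F = 2) {d : ℤ} (hd : Squarefree d) (hd1 : d ≠ 1)
    (hd4 : d % 4 = 1) (hx : ∃ x : F, x ^ 2 = (d : F)) : NumberField.discr F = d := by
  obtain ⟨x, hx⟩ := hx
  have hxr : x ∉ Set.range (algebraMap ℚ F) := by
    rintro ⟨r, rfl⟩
    have h : (algebraMap ℚ F) (r ^ 2) = algebraMap ℚ F (d : ℚ) := by
      rw [map_pow, hx, map_intCast]
    exact not_sq_eq_of_squarefree hd hd1 r ((algebraMap ℚ F).injective h)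
  have hc : x ^ 2 = algebraMap ℚ F (d : ℚ) := by rw [hx, map_intCast]
  obtain ⟨q, -, hq⟩ := NumberField.exists_discr_eq_mul_sq hF hxr hc
  exact Quadratic.eq_of_isFundamental_of_eq_mul_sq (Quadratic.isFundamentalDiscriminant_discr hF)
    (Or.inl ⟨hd4, hd, hd1⟩) hq

/-- **The field `ℚ(√d)`** for a square-free `d ≠ 1` (Mathlib's `QuadraticAlgebra ℚ d 0`, a field
since `d` is not a rational square): a number field of degree `2` with an element of square `d`, whose
discriminant is `d` when `d ≡ 1 (mod 4)`. [folklore] -/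
theorem exists_quadraticField_of_squarefree {d : ℤ} (hd : Squarefree d) (hd1 : d ≠ 1) :
    ∃ (F : Type) (_ : Field F) (_ : NumberField F),
      Module.finrank ℚ F = 2 ∧ (∃ x : F, x ^ 2 = (d : F)) ∧
        (d % 4 = 1 → NumberField.discr F = d) := by
  haveI : Fact (∀ r : ℚ, r ^ 2 ≠ (d : ℚ) + 0 * r) :=
    ⟨fun r h => not_sq_eq_of_squarefree hd hd1 r (by rw [h]; ring)⟩
  let L := QuadraticAlgebra ℚ (d : ℚ) 0
  haveI : NumberField L := NumberField.of_module_finite ℚ L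
  have h2L : Module.finrank ℚ L = 2 := by convert QuadraticAlgebra.finrank_eq_two (d : ℚ) (0 : ℚ)
  have hω : (QuadraticAlgebra.omega : L) ^ 2 = ((d : ℤ) : L) := by
    have h := QuadraticAlgebra.omega_mul_omega_eq_add (a := (d : ℚ)) (b := (0 : ℚ))
    rw [zero_smul, add_zero] at h
    rw [sq, h, ← map_intCast (algebraMap ℚ L) d, Algebra.algebraMap_eq_smul_one]
  refine ⟨L, inferInstance, inferInstance, h2L, ⟨_, hω⟩, fun hd4 => ?_⟩
  exact discr_eq_of_sq_eq h2L hd hd1 hd4 ⟨_, hω⟩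

end QuadraticField

/-! ## §2 Route A with arithmetic binders -/

section Explicit

variable (W : WeierstrassCurve ℚ) [W.IsElliptic]

omit [W.IsElliptic] in
/-- From the arithmetic binders on `(E, d)` to Mazur–Rubin's splitting binders for ANY quadratic
`F ∋ √d` (decomposition law, tree-proved). Bookkeeping. [cite: Marcus2018, Ch. 3 Thm. 25] -/
theorem mr_binders_of_arith {d : ℤ} (hd : Squarefree d) (hd1 : d ≠ 1) (hd8 : d % 8 = 1)
    (F : Type) [Field F] [NumberField F] (hF : Module.finrank ℚ F = 2) (hx : ∃ x : F, x ^ 2 = (d : F))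
    (hadd : ∀ (p : ℕ) [Fact p.Prime], ¬ W.HasGoodReductionAtPrime p →
      ¬ W.HasMultiplicativeReductionAtPrime p → p ≠ 2 → jacobiSym d p = 1)
    (hmev : ∀ (p : ℕ) [Fact p.Prime], W.HasMultiplicativeReductionAtPrime p →
      Even (padicValRat p W.Δ) → p ≠ 2 → jacobiSym d p = 1)
    (hreal : 0 < W.Δ → 0 < d)
    (hmodd : ∀ (p : ℕ) [Fact p.Prime], W.HasMultiplicativeReductionAtPrime p →
      Odd (padicValRat p W.Δ) → ¬ (p : ℤ) ∣ d)
    (hT : ∀ (p : ℕ) [Fact p.Prime], (p : ℤ) ∣ d →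
      ∀ Q : (W.baseChange ℚ_[p]).toAffine.Point, 2 • Q = 0 → Q = 0) :
    (∀ (p : ℕ) [Fact p.Prime], ¬ W.HasGoodReductionAtPrime p →
        ¬ W.HasMultiplicativeReductionAtPrime p → ((Ideal.span {(p : ℤ)}).primesOver (𝓞 F)).ncard = 2) ∧
    (∀ (p : ℕ) [Fact p.Prime], W.HasMultiplicativeReductionAtPrime p →
        Even (padicValRat p W.Δ) → ((Ideal.span {(p : ℤ)}).primesOver (𝓞 F)).ncard = 2) ∧
    ((Ideal.span {(2 : ℤ)}).primesOver (𝓞 F)).ncard = 2 ∧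
    (0 < W.Δ → NumberField.IsTotallyReal F) ∧
    (∀ (p : ℕ) [Fact p.Prime], W.HasMultiplicativeReductionAtPrime p →
        Odd (padicValRat p W.Δ) → ¬ (p : ℤ) ∣ NumberField.discr F) ∧
    (∀ (p : ℕ) [Fact p.Prime], (p : ℤ) ∣ NumberField.discr F →
        ∀ Q : (W.baseChange ℚ_[p]).toAffine.Point, 2 • Q = 0 → Q = 0) := by
  have hd4 : d % 4 = 1 := by omega
  have hdisc : NumberField.discr F = d := discr_eq_of_sq_eq hF hd hd1 hd4 hx
  have h2 : ((Ideal.span {(2 : ℤ)}).primesOver (𝓞 F)).ncard = 2 :=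
    (Quadratic.ncard_primesOver_two_eq_two_iff hF).mpr (by rw [hdisc]; exact hd8)
  have hsplit : ∀ (p : ℕ), p.Prime → (p ≠ 2 → jacobiSym d p = 1) →
      ((Ideal.span {(p : ℤ)}).primesOver (𝓞 F)).ncard = 2 := by
    intro p hp hj
    by_cases hp2 : p = 2
    · subst hp2; simpa using h2
    · exact (Quadratic.ncard_primesOver_eq_two_iff_jacobiSym hF hp hp2).mpr (by rw [hdisc]; exact hj hp2)
  refine ⟨fun p _ hg hm => hsplit p Fact.out (hadd p hg hm), fun p _ hm he => hsplit p Fact.out (hmev p hm he),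
    h2, fun hΔ => ?_, fun p _ hm ho => by rw [hdisc]; exact hmodd p hm ho,
    fun p _ hp => hT p (by rw [hdisc] at hp; exact hp)⟩
  have hpos : 0 < NumberField.discr F := by rw [hdisc]; exact hreal hΔ
  exact NumberField.nrComplexPlaces_eq_zero_iff.mp
    (Quadratic.nrRealPlaces_eq_two_and_nrComplexPlaces_eq_zero hF hpos).2

/-- **ROUTE A, ARITHMETIC BINDERS.** Let `E/ℚ` (model `W`) have `E(ℚ)[2] = 0`, `Ш(E/ℚ)[2] = 0`,
`rank E(ℚ) ≤ 1`, and let `d ≡ 1 (mod 8)` be square-free (so `2` splits in `ℚ(√d)`) with: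
`jacobiSym d ℓ = 1` for every odd prime `ℓ` of additive reduction and every odd multiplicative prime
with `ord_ℓ(Δ_E)` even (these split in `ℚ(√d)`); `ℓ ∤ d` for multiplicative primes with `ord_ℓ(Δ_E)`
odd; `d > 0` if `Δ_E > 0`; and `E(ℚ_q)[2] = 0` for every prime `q ∣ d` (`a_q(E)` odd). If
`Ш(E^{(d)}/ℚ)[2^∞]` is finite (Heegner input / GZK) then, granting Mazur–Rubin Cor. 3.4 (ii) (`hMR`)
and Cassels–Tate (`hCT`): `rank E^{(d)}(ℚ) = rank E(ℚ)` and `Ш(E^{(d)}/ℚ)[2^∞] = 0` for every model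
`W'` of `E^{(d)}`. (= `TransportA.routeA_rank_eq_and_sha_two_eq_bot` with the field `ℚ(√d)`
constructed and the splitting binders discharged by the decomposition law.)
[cite: MazurRubin2010, Cor. 3.4 (ii) with Prop. 3.3, and Prop. 4.2] [cite: Marcus2018, Ch. 3 Thm. 25] -/
theorem routeA_explicit (hMR : MazurRubin2010.cor34ii_rat) (hCT : exists_casselsTate_pairing (K := ℚ))
    {d : ℤ} (hd : Squarefree d) (hd1 : d ≠ 1) (hd8 : d % 8 = 1)
    (hadd : ∀ (p : ℕ) [Fact p.Prime], ¬ W.HasGoodReductionAtPrime p →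
      ¬ W.HasMultiplicativeReductionAtPrime p → p ≠ 2 → jacobiSym d p = 1)
    (hmev : ∀ (p : ℕ) [Fact p.Prime], W.HasMultiplicativeReductionAtPrime p →
      Even (padicValRat p W.Δ) → p ≠ 2 → jacobiSym d p = 1)
    (hreal : 0 < W.Δ → 0 < d)
    (hmodd : ∀ (p : ℕ) [Fact p.Prime], W.HasMultiplicativeReductionAtPrime p →
      Odd (padicValRat p W.Δ) → ¬ (p : ℤ) ∣ d)
    (hT : ∀ (p : ℕ) [Fact p.Prime], (p : ℤ) ∣ d →
      ∀ Q : (W.baseChange ℚ_[p]).toAffine.Point, 2 • Q = 0 → Q = 0)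
    (hW2 : W.toAffine.Point[(2 : ℤ)] = ⊥) (hWsha : (W.sha)[(2 : ℤ)] = ⊥) (hWr : W.mordellWeilRank ≤ 1)
    (W' : WeierstrassCurve ℚ) [W'.IsElliptic]
    (htw : ∃ C : VariableChange ℚ, C • W' = W.quadraticTwist (d : ℚ))
    (hfin : Finite (AddCommGroup.primaryComponent W'.sha 2)) :
    W'.mordellWeilRank = W.mordellWeilRank ∧ AddCommGroup.primaryComponent W'.sha 2 = ⊥ := by
  obtain ⟨F, _, _, hF, hx, -⟩ := exists_quadraticField_of_squarefree hd hd1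
  obtain ⟨h₁, h₂, h₃, h₄, h₅, h₆⟩ := mr_binders_of_arith W hd hd1 hd8 F hF hx hadd hmev hreal hmodd hT
  exact routeA_rank_eq_and_sha_two_eq_bot W hMR hCT hd hd1 F hF hx h₁ h₂ h₃ h₄ h₅ h₆ hW2 hWsha hWr
    W' htw hfin

/-- **ROUTE A, ARITHMETIC BINDERS — hand-over form.** Same binders, finiteness supplied as
`r_an(E^{(d)}) ≤ 1` (+ GZK `hGZK`): `rank E^{(d)} = rank E = r_an(E^{(d)})`, `Ш(E^{(d)})[2^∞] = 0`, and
`BSD(E^{(d)}, 2) ⟺ ord₂ #Ш_an(E^{(d)}) = 0`. [cite: MazurRubin2010, Cor. 3.4 (ii) with Prop. 3.3]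
[cite: Miller2011LMS, Def. 1.1] -/
theorem routeA_explicit_bsdp_iff (hMR : MazurRubin2010.cor34ii_rat)
    (hCT : exists_casselsTate_pairing (K := ℚ)) (hGZK : rank_eq_analyticRank_of_analyticRank_le_one)
    {d : ℤ} (hd : Squarefree d) (hd1 : d ≠ 1) (hd8 : d % 8 = 1)
    (hadd : ∀ (p : ℕ) [Fact p.Prime], ¬ W.HasGoodReductionAtPrime p →
      ¬ W.HasMultiplicativeReductionAtPrime p → p ≠ 2 → jacobiSym d p = 1)
    (hmev : ∀ (p : ℕ) [Fact p.Prime], W.HasMultiplicativeReductionAtPrime p →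
      Even (padicValRat p W.Δ) → p ≠ 2 → jacobiSym d p = 1)
    (hreal : 0 < W.Δ → 0 < d)
    (hmodd : ∀ (p : ℕ) [Fact p.Prime], W.HasMultiplicativeReductionAtPrime p →
      Odd (padicValRat p W.Δ) → ¬ (p : ℤ) ∣ d)
    (hT : ∀ (p : ℕ) [Fact p.Prime], (p : ℤ) ∣ d →
      ∀ Q : (W.baseChange ℚ_[p]).toAffine.Point, 2 • Q = 0 → Q = 0)
    (hW2 : W.toAffine.Point[(2 : ℤ)] = ⊥) (hWsha : (W.sha)[(2 : ℤ)] = ⊥) (hWr : W.mordellWeilRank ≤ 1)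
    (W' : WeierstrassCurve ℚ) [W'.IsElliptic]
    (htw : ∃ C : VariableChange ℚ, C • W' = W.quadraticTwist (d : ℚ)) (hr : W'.analyticRank ≤ 1) :
    W'.mordellWeilRank = W.mordellWeilRank ∧ W'.analyticRank = W.mordellWeilRank ∧
      AddCommGroup.primaryComponent W'.sha 2 = ⊥ ∧
      (BSDp W' 2 ↔ ∃ q : ℚ, shaAn W' = (q : ℂ) ∧ padicValRat 2 q = 0) := by
  obtain ⟨F, _, _, hF, hx, -⟩ := exists_quadraticField_of_squarefree hd hd1
  obtain ⟨h₁, h₂, h₃, h₄, h₅, h₆⟩ := mr_binders_of_arith W hd hd1 hd8 F hF hx hadd hmev hreal hmodd hT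
  exact routeA_bsdp_two_iff_shaAn_unit W hMR hCT hGZK hd hd1 F hF hx h₁ h₂ h₃ h₄ h₅ h₆ hW2 hWsha hWr
    W' htw hr

end Explicit

end Summit.BirchSwinnertonDyer.Uniform.U2

end
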